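import Mathlib
import Summits.MatrixMultiplication.MatrixMultiplication.Theses.CwPowerHosting

/-!
# Line `radix-carry-hosting` — crux `CwPowerHosting.HostingRateThree` (stmt-MatrixMultiplication-15970)

Crux-strategist line (planner-cstrat-stmt-MatrixMultiplication-15970-0, 2026-08-17).
Card: `Lines/radix-carry-hosting.md`.  Namespace `…Cruxes.HostingRateThree.RadixCarryHosting`.

THE TRANSFER.  By additive rigidity (route item `AdditiveRigidity`, candidate-proved) a free hosting of
`supp(xyz^{⊠N})` in an abelian group is a system of `N` value pairs `(p_i, q_i)` such that no nonempty
transversal of the sets `V_i = {±p_i, ±q_i, ±(p_i - q_i), -(p_i + q_i), 2p_i - q_i, 2q_i - p_i}` sums to `0`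
(route support item `PairsGiveHosting` is the constructive direction).  Writing `U = V ∪ {0}` as the image of
the ten COEFFICIENT PATTERNS `coeff : Fin 10 → ℤ × ℤ` (`(0,0), (±1,0), (0,±1), ±(1,-1), (-1,-1), (2,-1), (-1,2)`),
a hosting in a CYCLIC group `ℤ/M` is the same as INTEGER pairs whose nontrivial pattern-words have a nonzero
integer sum of absolute value `< M` (`stub_intPairsHosting`: integer zero-sum-free pairs with transversal bound
`M` ⇒ free hosting in `ZMod M`; this is `PairsGiveHosting` over `ℤ` plus reduction mod `M`, an M-sized lemma).
SELF-SIMILAR integer systems — a MENU of `k` pairs repeated at every scale `b^l` (RADIX systems) — are certified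
zero-sum-free for ALL numbers of levels `L` at once by a finite CARRY CERTIFICATE (`RadixCert`: the menu is
zero-sum-free, and the set `I` of nonzero carries is entered by every nontrivial level word divisible by `b` and
closed under `c ↦ (c + levelSum w)/b`, with `0 ∉ I`), because a vanishing multi-level sum read from the lowest
level is exactly a closed walk `0 → … → 0` in the carry graph (`stub_radixCompiler`, M-sized: induction on
levels + the geometric range bound `Σ_l W b^l < W' b^L`).  Host: `ZMod (W b^L + 1)`, `N = kL` pairs, RATE
`b^{1/k}` per pair.  Conversely every cyclic hosting of `N₀` pairs in `ℤ/M` is a carry-free radix menu with base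
`M` (lift the residues; nontrivial level sums are `≢ 0 mod M`), so RADIX RATE = CYCLIC RATE exactly: the heart
`stub_radixMenusRateThree` (for every `ε` a certified menu with `b ≤ 3^{(1+ε)k}`) IS `HostingRateThree`
restricted to cyclic hosts, in a form whose every instance is a finite, kernel-decidable certificate.

WHY THIS DOOR (what the language switch buys).  (1) Finite certificates beyond exhaustive search: the route's
data (`g(1)=4, g(2)=16, g(3)=64`, all abelian groups of order `< 4^N`, N ≤ 3) says nothing about towers; the
strategist's automaton search (exp/radix.py; kit j024328) is the first probe of `N → ∞` families, and the
BeatFour windows are FINITE: `k = 2, b ∈ [10,15]`; `k = 3, b ∈ [28,63]`; `k = 4, b ∈ [82,255]` (`b = 3^k` is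
excluded by the route's `ChainFloor`, which forbids `|H| = O(3^N)`).  (2) Carries are a real resource: for `k = 1`
the least carry-free base is `6` (= least cyclic host of one pair) but base `5` is certified WITH carries
(menu `(1,10)` or `(3,-5)`); for `k = 2` nothing is certified for `b ≤ 18` (digits `≤ 2b`) and the first menus
appear at `b = 19`: `{(5,-19),(10,-38)}`.  (3) An explicit infinite family (checked for `k ≤ 4` by the automaton,
provable by hand): menu `(a 2^j, -b 2^j)_{j<k}` with `a = 2^k + 1`, `b = a 2^k - 1 = 4^k + 2^k - 1` — the digit set
of the `S`-sums at one position is `a·[0,2^k) − [0,2^k)` (coarse bits from the `p`'s of level `l`, fine bits from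
the `q`'s of level `l-1`), `4^k` distinct digits of width `< b` — giving the FIRST cyclic hosts of rate `4 + o(1)`
(`5, √19 = 4.36, 71^{1/3} = 4.14, 271^{1/4} = 4.06, …`); previously every rate-4 host was a 2-group.  Beating `4`
needs a level design that is not "coarse bits − fine bits"; whether one exists for `k = 3` (`b < 64`) is exactly
what j024328 decides for digits `≤ 2b`.

HONEST STATUS OF THE HEART.  It is at least as hard as the crux restricted to cyclic hosts and the route's own
judgement (expected kill `HostingCapacityGap`, θ = 4) applies verbatim; the census (STRATEGY-CENSUS.md §N1) adds
that no pair-correlation (LP/Delsarte/Fourier-L²) certificate can ever prove θ > 3, so neither side has a tool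
today.  The line's value is the finite frontier (BeatFour ⇔ some certified menu with `b < 4^k`, now searchable
for `k = 3, 4`) and two reusable tool lemmas.

Disproof used: none exists for this crux (no `Disproof.lean`, no `_false_without_` theorem, no landed Negative
lemma; negatives index of the summit: no statement about hostings).  The stubs honour the route's floors: hosts
are cyclic of unbounded order and exponent (TwoGroupFloor / ThreeGroupFloor / TricoloredSumFree barrier concern
bounded exponent), and `b > 3^k` strictly is forced by `ChainFloor` (recorded, not assumed).
-/

set_option linter.dupNamespace false

namespace Summit.MatrixMultiplication.MatrixMultiplication.Cruxes.HostingRateThree.RadixCarryHosting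

open Finset
open Summit.MatrixMultiplication.MatrixMultiplication.Theses.CwPowerHosting (HostingRateThree)

/-! ## Definitions -/

/-- The ten coefficient patterns `(m, n)` of the values `m p + n q ∈ U(p,q) = {0} ∪ V(p,q)`:
`0, ±p, ±q, ±(p - q), -(p + q), 2p - q, 2q - p`.  Pattern `0` is the trivial one. -/
def coeff : Fin 10 → ℤ × ℤ :=
  ![(0, 0), (1, 0), (-1, 0), (0, 1), (0, -1), (1, -1), (-1, 1), (-1, -1), (2, -1), (-1, 2)]

/-- The integer sum of a pattern word `w` over the pairs `(p_i, q_i)`. -/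
def wordSum {N : ℕ} (p q : Fin N → ℤ) (w : Fin N → Fin 10) : ℤ :=
  ∑ i, ((coeff (w i)).1 * p i + (coeff (w i)).2 * q i)

/-- Integer pairs are ZERO-SUM-FREE if only the trivial pattern word sums to zero (this is (†) of the route over
`ℤ`; single-letter words give `p, q, p ± q, 2p - q, 2q - p ≠ 0`). -/
def IsZeroSumFree {N : ℕ} (p q : Fin N → ℤ) : Prop :=
  ∀ w : Fin N → Fin 10, wordSum p q w = 0 → ∀ i, w i = 0

/-- All pattern-word sums have absolute value `< M` (so that reduction mod `M` creates no new zero). -/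
def TransversalBound {N : ℕ} (p q : Fin N → ℤ) (M : ℕ) : Prop :=
  ∀ w : Fin N → Fin 10, |wordSum p q w| < M

/-- A free additive hosting of `supp(xyz^{⊠N})` (the `∃ α β γ` clause of `HostingRateThree`). -/
def IsFreeHosting {N : ℕ} {H : Type} [AddCommGroup H] (α β γ : (Fin N → Fin 3) → H) : Prop :=
  ∀ x y z : Fin N → Fin 3, α x + β y + γ z = 0 ↔ ∀ i, x i ≠ y i ∧ x i ≠ z i ∧ y i ≠ z i

/-- The radix tower of a menu `m : Fin k → ℤ` with base `b` and `L` levels: pair `(j, l)` carries `m j * b^l`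
(indexing through `finProdFinEquiv : Fin k × Fin L ≃ Fin (k * L)`). -/
def tower (k L b : ℕ) (m : Fin k → ℤ) : Fin (k * L) → ℤ :=
  fun i => m (finProdFinEquiv.symm i).1 * (b : ℤ) ^ ((finProdFinEquiv.symm i).2 : ℕ)

/-- CARRY CERTIFICATE of a radix menu `(pm, qm)` with base `b`: `I` is a set of NONZERO integers (the reachable
carries) such that (R1) the menu itself is zero-sum-free, (entry) every nontrivial level word whose sum is
divisible by `b` enters `I` with carry `sum / b`, (closure) from a carry `c ∈ I` every level word `w` with
`b ∣ c + sum w` leads to the carry `(c + sum w)/b ∈ I` — in particular never back to `0`.  Soundness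
(`stub_radixCompiler`): a vanishing `L`-level sum, read upward from its lowest nontrivial level, is a closed walk
at `0` in the carry graph, which the certificate excludes. -/
structure RadixCert (k b : ℕ) (pm qm : Fin k → ℤ) (I : Set ℤ) : Prop where
  zero_nmem : (0 : ℤ) ∉ I
  level_free : IsZeroSumFree pm qm
  entry : ∀ w : Fin k → Fin 10, (∃ j, w j ≠ 0) → (b : ℤ) ∣ wordSum pm qm w → wordSum pm qm w / b ∈ I
  closed : ∀ c ∈ I, ∀ w : Fin k → Fin 10, (b : ℤ) ∣ c + wordSum pm qm w → (c + wordSum pm qm w) / b ∈ I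

/-! ## Statements of the stubs as named `Prop`s (`Stmt.stub_*`) -/
namespace Stmt

/-- Statement of `stub_intPairsHosting` (TOOL, M).  **Integer pair systems give cyclic hostings.**  Zero-sum-free
integer pairs whose pattern sums are bounded by `M` in absolute value host `supp(xyz^{⊠N})` freely in `ZMod M`:
`γ z = Σ_i s_i(z_i)` with `s_i(0) = 0, s_i(1) = p_i, s_i(2) = q_i`, `α`, `β` the same map shifted by constants
summing to `-Σ_i (p_i + q_i)`; then `α x + β y + γ z = Σ_i (s(x_i) + s(y_i) + s(z_i) - p_i - q_i)` is the cast of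
the word sum of the pattern word `i ↦ pat (x_i, y_i, z_i)`, where the 6 good triples give pattern `0` and the 21
bad ones give the nine nontrivial patterns; `|sum| < M` makes "`= 0` in `ZMod M`" equivalent to "`= 0` in `ℤ`". -/
def stub_intPairsHosting : Prop :=
  ∀ (N M : ℕ) (p q : Fin N → ℤ), 1 ≤ M → IsZeroSumFree p q → TransversalBound p q M →
    ∃ α β γ : (Fin N → Fin 3) → ZMod M, IsFreeHosting α β γ

/-- Statement of `stub_radixCompiler` (TOOL, M).  **Carry certificates compile to towers.**  A certified radix
menu with base `b ≥ 2` gives, for every number of levels `L ≥ 1`, a zero-sum-free integer system of `k L` pairs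
(the tower) whose pattern sums are bounded by `W b^L` for a constant `W` (any `W ≥ Σ`-free bound
`max_w |wordSum pm qm w| · b/(b-1)` works: `Σ_{l<L} W₀ b^l < W₀ b^L/(b-1)`).  Proof plan: split a tower word into
its `L` level words (`finProdFinEquiv`), `wordSum (tower) w = Σ_l b^l · wordSum pm qm (w_l)`; if it vanishes and
some level is nontrivial, take the lowest nontrivial level `l₀`: divisibility by `b` there is `entry`, and the
successive carries `c_{l+1} = (c_l + wordSum (w_l))/b` stay in `I` by `closed`, contradicting `c_L = 0 ∉ I`. -/
def stub_radixCompiler : Prop :=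
  ∀ (k b : ℕ) (pm qm : Fin k → ℤ) (I : Set ℤ), 2 ≤ b → RadixCert k b pm qm I →
    ∃ W : ℕ, ∀ L : ℕ, 1 ≤ L →
      IsZeroSumFree (tower k L b pm) (tower k L b qm) ∧ TransversalBound (tower k L b pm) (tower k L b qm) (W * b ^ L)

/-- Statement of `stub_radixMenusRateThree` (HEART, open — `HostingRateThree` for cyclic hosts, in certificate
form).  For every `ε > 0` there is a certified radix menu of `k ≥ 1` pairs with base `b ≤ 3^{(1+ε)k}`.  Known:
`b = 3^k` is impossible (`ChainFloor`); certified menus exist with `b = 4^k + 2^k - 1` for every `k` (the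
coarse/fine-bit family, checked `k ≤ 4`), `k = 1`: least `b = 5`, `k = 2`: least `b = 19` among digits `≤ 2b`;
the BeatFour windows `b < 4^k` are open for `k ≥ 3` (kit j024328 runs `k = 3`). -/
def stub_radixMenusRateThree : Prop :=
  ∀ ε : ℝ, 0 < ε → ∃ (k b : ℕ) (pm qm : Fin k → ℤ) (I : Set ℤ),
    1 ≤ k ∧ 2 ≤ b ∧ RadixCert k b pm qm I ∧ (b : ℝ) ≤ (3 : ℝ) ^ ((1 + ε) * k)

end Stmt

/-! ## Registered stubs -/

/-- TOOL (M): integer zero-sum-free pairs with transversal bound `M` host freely in `ZMod M`. -/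
theorem stub_intPairsHosting : Stmt.stub_intPairsHosting := by
  sorry

/-- TOOL (M): a carry certificate compiles to zero-sum-free towers of every height with range `W b^L`. -/
theorem stub_radixCompiler : Stmt.stub_radixCompiler := by
  sorry

/-- HEART (open-problem): certified radix menus of rate `3^{1+ε}` per pair (= cyclic `HostingRateThree`). -/
theorem stub_radixMenusRateThree : Stmt.stub_radixMenusRateThree := by
  sorry

/-! ## Composition (kernel-checked, no sorry) -/

/-- Transversal bounds are monotone in `M`. -/
theorem transversalBound_mono {N : ℕ} {p q : Fin N → ℤ} {M M' : ℕ} (h : TransversalBound p q M)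
    (hMM' : M ≤ M') : TransversalBound p q M' :=
  fun w => lt_of_lt_of_le (h w) (by exact_mod_cast hMM')

/-- Rate bookkeeping: for `b ≤ 3^{(1+ε/2)k}` and any constant `W`, some height `L ≥ 1` has
`W b^L + 1 ≤ 3^{(1+ε)(kL)}`. -/
theorem exists_height {ε : ℝ} (hε : 0 < ε) {k b W : ℕ} (hk : 1 ≤ k) (hb : 2 ≤ b)
    (hrate : (b : ℝ) ≤ (3 : ℝ) ^ ((1 + ε / 2) * k)) :
    ∃ L : ℕ, 1 ≤ L ∧ ((W * b ^ L + 1 : ℕ) : ℝ) ≤ (3 : ℝ) ^ ((1 + ε) * ((k * L : ℕ) : ℝ)) := by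
  set a : ℝ := (3 : ℝ) ^ (ε / 2 * k) with ha_def
  have hkpos : (0 : ℝ) < k := by exact_mod_cast hk
  have ha : 1 < a := Real.one_lt_rpow (by norm_num) (by positivity)
  obtain ⟨n, hn⟩ := pow_unbounded_of_one_lt ((W : ℝ) + 1) ha
  refine ⟨n + 1, by omega, ?_⟩
  have hL1 : (1 : ℝ) ≤ ((n + 1 : ℕ) : ℝ) := by exact_mod_cast Nat.succ_le_succ (Nat.zero_le n)
  set L : ℕ := n + 1 with hL
  -- (W + 1) ≤ a^L = 3^{(ε/2) k L}
  have h1 : (W : ℝ) + 1 ≤ (3 : ℝ) ^ (ε / 2 * k * L) := by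
    have : a ^ n ≤ a ^ L := pow_le_pow_right₀ ha.le (by omega)
    have haL : a ^ L = (3 : ℝ) ^ (ε / 2 * k * L) := by
      rw [ha_def, ← Real.rpow_mul_natCast (by norm_num)]
    linarith [hn, this, haL.symm.le, haL.le]
  -- b^L ≤ 3^{(1+ε/2) k L}
  have hb0 : (0 : ℝ) ≤ b := by positivity
  have h2 : ((b : ℝ)) ^ L ≤ (3 : ℝ) ^ ((1 + ε / 2) * k * L) := by
    calc ((b : ℝ)) ^ L ≤ ((3 : ℝ) ^ ((1 + ε / 2) * k)) ^ L := pow_le_pow_left₀ hb0 hrate L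
      _ = (3 : ℝ) ^ ((1 + ε / 2) * k * L) := by rw [← Real.rpow_mul_natCast (by norm_num)]
  have hbL1 : (1 : ℝ) ≤ ((b : ℝ)) ^ L := one_le_pow₀ (by exact_mod_cast (by omega : 1 ≤ b))
  have h3pos : (0 : ℝ) < (3 : ℝ) ^ ((1 + ε / 2) * k * L) := by positivity
  have hW0 : (0 : ℝ) ≤ (W : ℝ) + 1 := by positivity
  calc ((W * b ^ L + 1 : ℕ) : ℝ) = (W : ℝ) * (b : ℝ) ^ L + 1 := by push_cast; ring
    _ ≤ ((W : ℝ) + 1) * (b : ℝ) ^ L := by nlinarith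
    _ ≤ (3 : ℝ) ^ (ε / 2 * k * L) * (3 : ℝ) ^ ((1 + ε / 2) * k * L) :=
        mul_le_mul h1 h2 (by positivity) (by positivity)
    _ = (3 : ℝ) ^ ((1 + ε) * ((k * L : ℕ) : ℝ)) := by
        rw [← Real.rpow_add (by norm_num)]; push_cast; ring_nf

/-- The line concludes the crux BY NAME: integer-hosting tool + carry compiler + certified menus of rate three
⇒ `HostingRateThree`, with cyclic hosts `ZMod (W b^L + 1)`. -/
theorem HostingRateThree_of :
    Stmt.stub_intPairsHosting → Stmt.stub_radixCompiler → Stmt.stub_radixMenusRateThree → HostingRateThree := by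
  intro hA hB hH ε hε
  obtain ⟨k, b, pm, qm, I, hk, hb, hcert, hrate⟩ := hH (ε / 2) (by positivity)
  obtain ⟨W, hW⟩ := hB k b pm qm I hb hcert
  obtain ⟨L, hL, hM⟩ := exists_height hε (W := W) hk hb hrate
  obtain ⟨hfree, hbound⟩ := hW L hL
  set M : ℕ := W * b ^ L + 1 with hMdef
  have hM1 : 1 ≤ M := by omega
  obtain ⟨α, β, γ, hhost⟩ :=
    hA (k * L) M (tower k L b pm) (tower k L b qm) hM1 hfree (transversalBound_mono hbound (by omega))
  refine ⟨k * L, ZMod M, inferInstance, inferInstance, ?_, ?_, α, β, γ, hhost⟩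
  · exact Nat.le_trans hk (Nat.le_mul_of_pos_right k hL)
  · rw [ZMod.card M]
    exact hM

/-- The crux modulo the registered stubs. -/
theorem HostingRateThree_proof : HostingRateThree :=
  HostingRateThree_of stub_intPairsHosting stub_radixCompiler stub_radixMenusRateThree

/-! ## In-kernel sanity of the data (decidable instances; not stubs) -/

/-- The `k = 1`, base-`5` menu `(3, -5)` has no nontrivial zero pattern and its carry certificate uses
`I = {-1, 1, -2, 2, -3, 3, -4, 4} ∖ …` — here we only record the cheapest in-kernel fact: the nine nontrivial
pattern values of `(p, q) = (3, -5)` are nonzero and pairwise distinct from their negatives' partners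
(`decide`), i.e. `ℤ` hosts one pair; the full certificate check is `exp/radix.py` (automaton) and is what the
lead turns into a `decide` on a `Finset ℤ` once `stub_radixCompiler` fixes the certificate format. -/
example : ∀ i : Fin 10, i ≠ 0 → (coeff i).1 * 3 + (coeff i).2 * (-5) ≠ 0 := by decide

end Summit.MatrixMultiplication.MatrixMultiplication.Cruxes.HostingRateThree.RadixCarryHosting
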